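import Summits.KontsevichZagierPeriods.Zeta5Search.Certificates.RecordRayDenominatorsBricks
import Summits.KontsevichZagierPeriods.Zeta5Search.Certificates.RayC1KernelStepTailSharp
import Literature.NumberTheory.Irrationality.Hata1992.TruncatedStepFactor
import HarnessLib

/-!
# ζ(5) search — the record ray's DENOMINATORS, XIII: the UNIFORM BRICK TAIL (all shifts `m ≥ 16` as ONE periodic step factor) (p3 g7)

HONEST FRAMING: systematic search; no irrationality claim unless certified.  Valuation bookkeeping of explicit rationals on
Brown–Zudilin's record ray; nothing here is a statement about `ζ(5)`; every exponent this feeds is `< 1`.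

OUR work (Summit side; prover seat p3, generation 7).  The window tables of files XI/XII (`BWin`, `okShape` forces `θ = p/n > 1/16`)
stop at the shift `m = ⌊n/p⌋ = 15`; below `θ = 1/16` the kernel so far carried the bare baseline `M0` (census g37
REC-BRICKS-LEDGER §2: `0.594` nats on `θ < 1/16` against the by-name brick tail).  Following typer g17's `RayC1KernelStepTail`
for the ray C1, this file removes fam-denom's brick exponent `2c` (Zudilin's (8.11) on the 245 certified `ν`-cells
`Denom.RecordRayNuCells.nuCells`, consumer form `Denom.RecordRayBrickCells.brick_cell`) at EVERY shift `16 ≤ m ≤ K(n)`,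
`K(n) = ⌊√(n/41)⌋ − 1` (so every prime used has `p² > 41n`), as ONE factor: the truncated periodic step factor of the tree
(`Hata1992.TruncatedStepFactor.stepFactorTrunc`, [Zudilin 2004, §8 (8.8)–(8.9); Hata 1992, §2]) of the step function
`φ = Σ_i 2c_i·1_{[a0_i/b0_i, a1_i/b1_i)}`:
* `tU/tV/tc`, `nuCells_ok` (validity of the 245 cells, `decide`), `cellWins_chain` (sorted and disjoint, `decide`),
  `stepFun_cells` (the step function is `2c_i` on cell `i`, `0` off the cells);
* `tail_prime_dvd` — for a prime with `1 ≤ ⌊n/p⌋ ≤ K`, `41(K+1)² ≤ n`: `p^{φ({n/p})}` divides the multiplied wedge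
  `z_{W′}z_V − z_W z_{V′}` and the multiplied Q-minor `d⁵(z_U z_{W′} − z_{U′} z_W)` (the shape of `BWin.Sound`);
* `tailFactor n = stepFactorTrunc … 16 (K n) n`, `tailFactor_dvd` (both integers, `n ≥ 11849 = 41·17²`), `tailFactor_mono`;
* the RATE by cert-1 g6's closed-form minorant `RayC1.fracRate_ge_sharp` (`S(u,v,16) ≥ (v−u)/(16 − 1/2 + 1/128 + (u+v)/2)`):
  `tailRateQ_ge` (the exact cell sum `≥ 3046/10000`, `decide` in `ℚ`), `tailRate_ge : Σ_i 2c_i·S(u_i,v_i,16) ≥ 0.3046`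
  (digamma value `0.30475`), and `eventually_exp_le_tailFactor` — `e^{(0.3046 − ε)n} ≤ tailFactor n` for large `n`.
The table theorem with this factor (multiplier `ML l n / tailFactor n`) is file XIII-b `RecordRayStepTailTable`.
-/

noncomputable section

open Finset Real Filter Topology

namespace Summit.KontsevichZagierPeriods.Zeta5Search.RecordRay

namespace BrickTail

open Summit.KontsevichZagierPeriods.Zeta5Search.DualSeries
open Summit.KontsevichZagierPeriods.Zeta5Search.DualSeriesDenominators
open Summit.KontsevichZagierPeriods.Zeta5Search.WedgeDictionary
open Summit.KontsevichZagierPeriods.Zeta5Search.DualSeriesLemma19 (bRecord)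
open Summit.KontsevichZagierPeriods.Zeta5Search.RayKernel (WinEntry chainOK chainOK_sorted getElem_all)
open Summit.KontsevichZagierPeriods.Zeta5Search.Denom.DigitCert (Cell)
open Summit.KontsevichZagierPeriods.Zeta5Search.Denom.RecordRayNuCells (nuCells)
open Summit.KontsevichZagierPeriods.Zeta5Search.Denom.RecordRayBrickCells (brick_cell)
open Literature.NumberTheory.Irrationality.Hata1992

/-! ### The step function of the record ray's ν-cells -/

/-- Index type of the 245 certified `ν`-cells of the record ray. -/
abbrev TI : Type := Fin nuCells.length

/-- Left endpoint `a0/b0` of cell `i` (fractional-part window). -/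
def tU (i : TI) : ℝ := ((nuCells[(i : ℕ)]).a0 : ℝ) / ((nuCells[(i : ℕ)]).b0 : ℝ)

/-- Right endpoint `a1/b1` of cell `i`. -/
def tV (i : TI) : ℝ := ((nuCells[(i : ℕ)]).a1 : ℝ) / ((nuCells[(i : ℕ)]).b1 : ℝ)

/-- Weight `2c` of cell `i`. -/
def tc (i : TI) : ℕ := (2 * (nuCells[(i : ℕ)]).c).toNat

/-- Decidable validity of a cell: `0 < a0`, `0 < b0 ≤ 41`, `a0·b1 < a1·b0`, `a1 ≤ b1`, `0 < b1 ≤ 41`, `0 ≤ c`. -/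
def cellOK (C : Cell) : Bool :=
  decide (0 < C.a0) && decide (0 < C.b0) && decide (C.a0 * (C.b1 : ℤ) < C.a1 * (C.b0 : ℤ)) && decide (C.a1 ≤ (C.b1 : ℤ)) &&
  decide (0 < C.b1) && decide (0 ≤ C.c) && decide (C.b0 ≤ 41) && decide (C.b1 ≤ 41)

/-- Every cell of the record ray is valid. -/
theorem nuCells_ok : nuCells.all cellOK = true := by decide +kernel

/-- The validity facts of cell `i`. -/
theorem cell_ok (i : TI) :
    0 < (nuCells[(i : ℕ)]).a0 ∧ 0 < (nuCells[(i : ℕ)]).b0 ∧ (nuCells[(i : ℕ)]).a0 * ((nuCells[(i : ℕ)]).b1 : ℤ) < (nuCells[(i : ℕ)]).a1 * ((nuCells[(i : ℕ)]).b0 : ℤ) ∧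
      (nuCells[(i : ℕ)]).a1 ≤ ((nuCells[(i : ℕ)]).b1 : ℤ) ∧ 0 < (nuCells[(i : ℕ)]).b1 ∧ 0 ≤ (nuCells[(i : ℕ)]).c ∧
      (nuCells[(i : ℕ)]).b0 ≤ 41 ∧ (nuCells[(i : ℕ)]).b1 ≤ 41 := by
  have h := getElem_all nuCells_ok i i.isLt
  simp only [cellOK, Bool.and_eq_true, decide_eq_true_eq, and_assoc] at h
  exact h

/-- `0 < u_i < v_i ≤ 1` for every cell. -/
theorem tUV : ∀ i ∈ (Finset.univ : Finset TI), 0 < tU i ∧ tU i < tV i ∧ tV i ≤ 1 := by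
  intro i _
  obtain ⟨ha0, hb0, hlt, ha1b1, hb1, -, -, -⟩ := cell_ok i
  have hb0r : (0 : ℝ) < ((nuCells[(i : ℕ)]).b0 : ℝ) := by exact_mod_cast hb0
  have hb1r : (0 : ℝ) < ((nuCells[(i : ℕ)]).b1 : ℝ) := by exact_mod_cast hb1
  refine ⟨div_pos (by exact_mod_cast ha0) hb0r, ?_, ?_⟩
  · unfold tU tV
    rw [div_lt_div_iff₀ hb0r hb1r]
    exact_mod_cast hlt
  · unfold tV
    rw [div_le_one hb1r]
    exact_mod_cast ha1b1

/-- The cells as a window list (for the sortedness check). -/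
def cellWins : List WinEntry := nuCells.map fun C => (((C.a0 : ℚ)) / C.b0, ((C.a1 : ℚ)) / C.b1, 0, 0)

/-- The cells are sorted and separated: `v_i ≤ u_{i+1}`. -/
theorem cellWins_chain : chainOK cellWins = true := by decide +kernel

/-- `v_i ≤ u_j` for `i < j`. -/
theorem tV_le_tU {i j : TI} (hij : i < j) : tV i ≤ tU j := by
  have hlen : cellWins.length = nuCells.length := by simp [cellWins]
  have h := chainOK_sorted cellWins_chain i j hij (by rw [hlen]; exact j.isLt)
  have ei : (cellWins[(i : ℕ)]'(by rw [hlen]; exact i.isLt)).2.1 = ((nuCells[(i : ℕ)]).a1 : ℚ) / (nuCells[(i : ℕ)]).b1 := by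
    simp [cellWins, List.getElem_map]
  have ej : (cellWins[(j : ℕ)]'(by rw [hlen]; exact j.isLt)).1 = ((nuCells[(j : ℕ)]).a0 : ℚ) / (nuCells[(j : ℕ)]).b0 := by
    simp [cellWins, List.getElem_map]
  rw [ei, ej] at h
  unfold tV tU
  have h' : ((((nuCells[(i : ℕ)]).a1 : ℚ) / (nuCells[(i : ℕ)]).b1 : ℚ) : ℝ) ≤ ((((nuCells[(j : ℕ)]).a0 : ℚ) / (nuCells[(j : ℕ)]).b0 : ℚ) : ℝ) := by
    exact_mod_cast h
  push_cast at h'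
  exact h'

/-- **The step function on and off the cells**: `φ(y) = 2c_i` if `u_i ≤ y < v_i`, and `φ(y) = 0` if no cell contains `y`. -/
theorem stepFun_cells (y : ℝ) :
    (∃ i : TI, (tU i ≤ y ∧ y < tV i) ∧ stepFun Finset.univ tU tV tc y = tc i) ∨ stepFun Finset.univ tU tV tc y = 0 := by
  classical
  by_cases h : ∃ i : TI, tU i ≤ y ∧ y < tV i
  · obtain ⟨i, hi⟩ := h
    left
    refine ⟨i, hi, ?_⟩
    unfold stepFun
    rw [Finset.sum_eq_single i]
    · rw [if_pos hi]
    · intro j _ hji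
      rw [if_neg]
      rintro ⟨h1, h2⟩
      rcases lt_or_gt_of_ne hji with hlt | hlt
      · have := tV_le_tU hlt; linarith [hi.1]
      · have := tV_le_tU hlt; linarith [hi.2]
    · intro hi'; exact absurd (Finset.mem_univ i) hi'
  · right
    unfold stepFun
    refine Finset.sum_eq_zero fun j _ => ?_
    rw [if_neg]
    exact fun hj => h ⟨j, hj⟩

/-! ### The per-prime certificate at every shift -/

section PerPrime

variable {n p : ℕ}

/-- **Every shift at once**: for `n ≥ 1` and a prime `p` with `1 ≤ ⌊n/p⌋ ≤ K` and `41(K+1)² ≤ n`, `p^{φ({n/p})}` divides the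
multiplied wedge and the multiplied Q-minor of the record ray (fam-denom's `brick_cell` at the shift `m = ⌊n/p⌋`). -/
theorem tail_prime_dvd {K : ℕ} (hn : 1 ≤ n) (hp : p.Prime) (hk1 : 1 ≤ ⌊(n : ℝ) / p⌋₊) (hkK : ⌊(n : ℝ) / p⌋₊ ≤ K)
    (hKn : 41 * (K + 1) ^ 2 ≤ n)
    {zW zV zW' zV' zU zU' : ℤ}
    (hzW : dRec n ^ 3 * sharpNormaliser (bRecord n) * coeffW (bRecord n) = zW)
    (hzV : dRec n ^ 6 * sharpNormaliser (bRecord n) * coeffV (bRecord n) = zV)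
    (hzW' : dRec n ^ 3 * sharpNormaliser (bRecord' n) * coeffW (bRecord' n) = zW')
    (hzV' : dRec n ^ 6 * sharpNormaliser (bRecord' n) * coeffV (bRecord' n) = zV')
    (hzU : dRec n * sharpNormaliser (bRecord n) * coeffU (bRecord n) = zU)
    (hzU' : dRec n * sharpNormaliser (bRecord' n) * coeffU (bRecord' n) = zU') :
    (p : ℤ) ^ stepFun Finset.univ tU tV tc (Int.fract ((n : ℝ) / p)) ∣ (zW' * zV - zW * zV') ∧
      (p : ℤ) ^ stepFun Finset.univ tU tV tc (Int.fract ((n : ℝ) / p)) ∣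
        ((Nat.lcmUpto (41 * n) : ℤ) ^ 5 * (zU * zW') - (Nat.lcmUpto (41 * n) : ℤ) ^ 5 * (zU' * zW)) := by
  set x : ℝ := (n : ℝ) / p with hx
  set m : ℕ := ⌊x⌋₊ with hm
  have hp0 : (0 : ℝ) < p := by exact_mod_cast hp.pos
  have hx0 : 0 ≤ x := by positivity
  have hfract : Int.fract x = x - (m : ℝ) := by
    rw [Int.fract, hm, natCast_floor_eq_intCast_floor hx0]
  -- n/p ≥ 1 ⇒ p ≤ n; n/p < K+1 ⇒ (K+1) p > n ⇒ p > 41 (K+1), p² > 41 n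
  have hpn : p ≤ n := by
    by_contra hcon
    have h1 : x < 1 := by rw [hx, div_lt_one hp0]; exact_mod_cast (not_le.1 hcon)
    have : ⌊x⌋₊ = 0 := Nat.floor_eq_zero.2 h1
    omega
  have hxK : x < (K : ℝ) + 1 := by
    have := Nat.lt_floor_add_one x
    have hmK : (⌊x⌋₊ : ℝ) ≤ K := by exact_mod_cast hkK
    linarith
  have hnKp : (n : ℝ) < ((K : ℝ) + 1) * p := by rwa [hx, div_lt_iff₀ hp0] at hxK
  have hKn' : (41 : ℝ) * ((K : ℝ) + 1) ^ 2 ≤ n := by exact_mod_cast hKn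
  have hK1 : (0 : ℝ) < (K : ℝ) + 1 := by positivity
  have hp41r : (41 : ℝ) * ((K : ℝ) + 1) < p := by
    by_contra hcon
    have hcon' : (p : ℝ) ≤ 41 * ((K : ℝ) + 1) := not_lt.1 hcon
    have : ((K : ℝ) + 1) * p ≤ ((K : ℝ) + 1) * (41 * ((K : ℝ) + 1)) := by gcongr
    nlinarith
  have hp41r' : (41 : ℝ) < p := by nlinarith
  have hp41 : 41 < p := by exact_mod_cast hp41r'
  have hsq : 41 * n < p ^ 2 := by
    have : (41 : ℝ) * n < (p : ℝ) ^ 2 := by nlinarith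
    exact_mod_cast this
  have hpB : p ≤ 41 * n := by omega
  rcases stepFun_cells (Int.fract x) with ⟨i, ⟨hlo, hhi⟩, heq⟩ | h0
  · rw [heq]
    clear heq
    obtain ⟨C, hCmem, hCeq⟩ : ∃ C : Cell, C ∈ nuCells ∧ nuCells[(i : ℕ)] = C := ⟨_, List.getElem_mem i.isLt, rfl⟩
    obtain ⟨ha0, hb0, hlt, ha1b1, hb1, hc0, hb041, hb141⟩ := cell_ok i
    unfold tU at hlo
    unfold tV at hhi
    have htc : tc i = (2 * C.c).toNat := by unfold tc; rw [hCeq]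
    rw [htc]
    rw [hCeq] at hlo hhi ha0 hb0 hlt ha1b1 hb1 hc0 hb041 hb141
    clear hCeq htc
    rw [hfract] at hlo hhi
    have hb0r : (0 : ℝ) < (C.b0 : ℝ) := by exact_mod_cast hb0
    have hb1r : (0 : ℝ) < (C.b1 : ℝ) := by exact_mod_cast hb1
    -- p ∤ n (else {n/p} = 0 < u_i)
    have hupos : (0 : ℝ) < (C.a0 : ℝ) / (C.b0 : ℝ) := div_pos (by exact_mod_cast ha0) hb0r
    have hnd : ¬ p ∣ n := by
      rintro ⟨q, hq⟩
      have hxq : x = (q : ℝ) := by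
        rw [hx, hq]; push_cast; field_simp
      have hm' : (m : ℝ) = q := by rw [hm, hxq, Nat.floor_natCast]
      have : x - (m : ℝ) = 0 := by rw [hxq, hm']; ring
      rw [this] at hlo
      linarith
    -- integer forms of the cell inequalities
    have e1 : (C.a0 : ℝ) * p ≤ (C.b0 : ℝ) * ((n : ℝ) - (m : ℝ) * p) := by
      rw [div_le_iff₀ hb0r] at hlo
      have e : ((n : ℝ) / p - m) * (C.b0 : ℝ) * p = (C.b0 : ℝ) * ((n : ℝ) - (m : ℝ) * p) := by field_simp
      nlinarith [mul_le_mul_of_nonneg_right hlo hp0.le]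
    have e2 : (C.b1 : ℝ) * ((n : ℝ) - (m : ℝ) * p) < (C.a1 : ℝ) * p := by
      rw [lt_div_iff₀ hb1r] at hhi
      have e : ((n : ℝ) / p - m) * (C.b1 : ℝ) * p = (C.b1 : ℝ) * ((n : ℝ) - (m : ℝ) * p) := by field_simp
      nlinarith [mul_lt_mul_of_pos_right hhi hp0]
    have e1z : C.a0 * (p : ℤ) ≤ (C.b0 : ℤ) * ((n : ℤ) - m * p) := by exact_mod_cast e1
    have e2z : (C.b1 : ℤ) * ((n : ℤ) - m * p) < C.a1 * (p : ℤ) := by exact_mod_cast e2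
    have e1s : C.a0 * (p : ℤ) < (C.b0 : ℤ) * ((n : ℤ) - m * p) := by
      rcases e1z.lt_or_eq with h | h
      · exact h
      · exfalso
        have hdvd : (p : ℤ) ∣ (C.b0 : ℤ) * n := ⟨C.a0 + (C.b0 : ℤ) * m, by linarith⟩
        have hdvd' : p ∣ C.b0 * n := by exact_mod_cast hdvd
        rcases (Nat.Prime.dvd_mul hp).1 hdvd' with h3 | h3
        · exact absurd (Nat.le_of_dvd hb0 h3) (by omega)
        · exact hnd h3
    have hk : (((2 * C.c).toNat : ℕ) : ℤ) ≤ 2 * C.c := by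
      rw [Int.toNat_of_nonneg (by linarith)]
    exact brick_cell hCmem hn hp hp41 hpB hsq m e1s e2z hk hzW hzV hzW' hzV' hzU hzU'
  · rw [h0, pow_zero]; exact ⟨one_dvd _, one_dvd _⟩

end PerPrime

/-! ### The tail factor -/

/-- The growing truncation `K(n) = ⌊√(n/41)⌋ − 1`. -/
def Kn (n : ℕ) : ℕ := Nat.sqrt (n / 41) - 1

/-- `41·(K(n)+1)² ≤ n` and `K(n) ≥ 16` for `n ≥ 41·17² = 11849`. -/
theorem Kn_spec {n : ℕ} (hn : 11849 ≤ n) : 16 ≤ Kn n ∧ 41 * (Kn n + 1) ^ 2 ≤ n := by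
  unfold Kn
  have h1 : 17 ≤ Nat.sqrt (n / 41) := by
    rw [Nat.le_sqrt]; omega
  have h2 : Nat.sqrt (n / 41) ^ 2 ≤ n / 41 := Nat.sqrt_le' (n / 41)
  constructor
  · omega
  · have : Nat.sqrt (n / 41) - 1 + 1 = Nat.sqrt (n / 41) := by omega
    rw [this]
    have h3 : 41 * (n / 41) ≤ n := Nat.mul_div_le n 41
    nlinarith

/-- **The uniform tail factor** of the record ray: the truncated step factor of the cells' step function, shifts `16 ≤ m ≤ K(n)`. -/
def tailFactor (n : ℕ) : ℕ := stepFactorTrunc (Finset.univ : Finset TI) tU tV tc 16 (Kn n) n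

/-- Positivity of the tail factor. -/
theorem tailFactor_pos (n : ℕ) : 0 < tailFactor n := stepFactorTrunc_pos _ _ _ _ _ _ _

/-- **The tail factor divides both integers of the record ray** (`n ≥ 11849`): the multiplied wedge and the multiplied Q-minor. -/
theorem tailFactor_dvd {n : ℕ} (hn : 11849 ≤ n)
    {zW zV zW' zV' zU zU' : ℤ}
    (hzW : dRec n ^ 3 * sharpNormaliser (bRecord n) * coeffW (bRecord n) = zW)
    (hzV : dRec n ^ 6 * sharpNormaliser (bRecord n) * coeffV (bRecord n) = zV)
    (hzW' : dRec n ^ 3 * sharpNormaliser (bRecord' n) * coeffW (bRecord' n) = zW')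
    (hzV' : dRec n ^ 6 * sharpNormaliser (bRecord' n) * coeffV (bRecord' n) = zV')
    (hzU : dRec n * sharpNormaliser (bRecord n) * coeffU (bRecord n) = zU)
    (hzU' : dRec n * sharpNormaliser (bRecord' n) * coeffU (bRecord' n) = zU') :
    ((tailFactor n : ℕ) : ℤ) ∣ (zW' * zV - zW * zV') ∧
      ((tailFactor n : ℕ) : ℤ) ∣ ((Nat.lcmUpto (41 * n) : ℤ) ^ 5 * (zU * zW') - (Nat.lcmUpto (41 * n) : ℤ) ^ 5 * (zU' * zW)) := by
  obtain ⟨h16, hKn⟩ := Kn_spec hn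
  have hn1 : 1 ≤ n := by omega
  have key : ∀ z : ℤ, (∀ p : ℕ, p.Prime → 16 ≤ ⌊(n : ℝ) / p⌋₊ → ⌊(n : ℝ) / p⌋₊ ≤ Kn n →
      (p : ℤ) ^ stepFun Finset.univ tU tV tc (Int.fract ((n : ℝ) / p)) ∣ z) → ((tailFactor n : ℕ) : ℤ) ∣ z := by
    intro z hz
    by_cases hz0 : z = 0
    · rw [hz0]; exact dvd_zero _
    · have hm : z.natAbs ≠ 0 := Int.natAbs_ne_zero.2 hz0
      have hdvd : tailFactor n ∣ z.natAbs := by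
        unfold tailFactor
        refine stepFactorTrunc_dvd_of_le_padicValNat tUV hm fun p hp hlo hhi => ?_
        haveI := Fact.mk hp
        have h := hz p hp hlo hhi
        rw [← Int.natAbs_dvd_natAbs] at h
        simp only [Int.natAbs_pow, Int.natAbs_natCast] at h
        exact (padicValNat_dvd_iff_le hm).1 h
      exact Int.natCast_dvd.2 hdvd
  exact ⟨key _ fun p hp hlo hhi => (tail_prime_dvd hn1 hp (by omega) hhi hKn hzW hzV hzW' hzV' hzU hzU').1,
    key _ fun p hp hlo hhi => (tail_prime_dvd hn1 hp (by omega) hhi hKn hzW hzV hzW' hzV' hzU hzU').2⟩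

/-- A prime of the tail factor has `⌊n/p⌋ ≥ 16`, i.e. `16·q ≤ n`. -/
theorem le_of_dvd_tailFactor {n q : ℕ} (hq : q.Prime) (hdvd : q ∣ tailFactor n) : 16 * q ≤ n := by
  haveI := Fact.mk hq
  have hv : 0 < padicValNat q (tailFactor n) :=
    one_le_padicValNat_of_dvd (tailFactor_pos n).ne' hdvd
  unfold tailFactor at hv
  rw [padicValNat_stepFactorTrunc tUV hq] at hv
  split_ifs at hv with h
  · have h16 : (16 : ℕ) ≤ ⌊(n : ℝ) / q⌋₊ := h.1
    clear hv h
    have hq0 : (0 : ℝ) < q := by exact_mod_cast hq.pos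
    have : (16 : ℝ) ≤ (n : ℝ) / q := le_trans (by exact_mod_cast h16) (Nat.floor_le (by positivity))
    rw [le_div_iff₀ hq0] at this
    exact_mod_cast this
  · exact absurd hv (lt_irrefl 0)

/-- `stepFactorTrunc` is monotone in the truncation `K` (more windows, more factors `≥ 1`). -/
theorem tailFactor_mono {K K' : ℕ} (h : K ≤ K') (k₀ n : ℕ) :
    stepFactorTrunc (Finset.univ : Finset TI) tU tV tc k₀ K n ∣ stepFactorTrunc (Finset.univ : Finset TI) tU tV tc k₀ K' n := by
  unfold stepFactorTrunc
  refine Finset.prod_dvd_prod_of_dvd _ _ fun i _ => pow_dvd_pow_of_dvd ?_ _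
  unfold fracProdTrunc
  exact Finset.prod_dvd_prod_of_subset _ _ _ (Finset.Ico_subset_Ico_right (by omega))

/-! ### The rate of the tail -/

/-- The closed-form per-cell minorant at `m₀ = 16`, `2c·(v − u)/(16 − 1/2 + 1/128 + (u+v)/2)`, as a rational. -/
def tailTermQ (C : Cell) : ℚ :=
  (((2 * C.c).toNat : ℕ) : ℚ) *
    (((C.a1 : ℚ) / C.b1 - (C.a0 : ℚ) / C.b0) / (16 - 1 / 2 + 1 / 128 + ((C.a0 : ℚ) / C.b0 + (C.a1 : ℚ) / C.b1) / 2))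

/-- The exact cell sum of the closed-form minorants is at least `3046/10000` (kernel arithmetic in `ℚ`; its value is `0.304700…`,
the digamma value of the tail rate `0.304750…`). -/
theorem tailRateQ_ge : (3046 / 10000 : ℚ) ≤ (nuCells.map tailTermQ).sum := by
  decide +kernel

/-- **The rate of the tail is at least `0.3046`**: `Σ_i 2c_i · S(u_i, v_i, 16) ≥ 3046/10000`. -/
theorem tailRate_ge : (3046 / 10000 : ℝ) ≤ ∑ i : TI, (tc i : ℝ) * fracRate (tU i) (tV i) 16 := by
  have h1 : ∑ i : TI, (tc i : ℝ) * ((tV i - tU i) / ((16 : ℕ) - 1 / 2 + 1 / (8 * (16 : ℕ)) + (tU i + tV i) / 2)) ≤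
      ∑ i : TI, (tc i : ℝ) * fracRate (tU i) (tV i) 16 := by
    refine Finset.sum_le_sum fun i hi => ?_
    obtain ⟨hu, huv, -⟩ := tUV i hi
    exact mul_le_mul_of_nonneg_left (RayC1.fracRate_ge_sharp hu huv.le (by norm_num : 1 ≤ 16)) (Nat.cast_nonneg _)
  refine le_trans ?_ h1
  -- the left side is the image of the exact rational cell sum
  have h2 : (((nuCells.map tailTermQ).sum : ℚ) : ℝ)
      = ∑ i : TI, (tc i : ℝ) * ((tV i - tU i) / ((16 : ℕ) - 1 / 2 + 1 / (8 * (16 : ℕ)) + (tU i + tV i) / 2)) := by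
    have e0 : (nuCells.map tailTermQ).sum = ∑ i : TI, tailTermQ (nuCells[(i : ℕ)]) := by
      rw [← Fin.sum_ofFn, List.ofFn_getElem_eq_map]
    rw [e0, Rat.cast_sum]
    refine Finset.sum_congr rfl fun i _ => ?_
    simp only [tailTermQ, tc, tU, tV]
    push_cast
    ring
  rw [← h2]
  have e : (3046 / 10000 : ℝ) = ((3046 / 10000 : ℚ) : ℝ) := by norm_num
  rw [e]
  exact Rat.cast_le.2 tailRateQ_ge

/-- **Size of the tail factor**: for every `ε > 0`, eventually `e^{(0.3046 − ε)n} ≤ tailFactor n`. -/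
theorem eventually_exp_le_tailFactor {ε : ℝ} (hε : 0 < ε) :
    ∀ᶠ n : ℕ in atTop, Real.exp ((3046 / 10000 - ε) * n) ≤ ((tailFactor n : ℕ) : ℝ) := by
  obtain ⟨K₁, hK₁⟩ := exists_trunc_eventually_exp_le (s := (Finset.univ : Finset TI)) (c := tc) tUV 16 hε
  have hKn : ∀ᶠ n : ℕ in atTop, K₁ ≤ Kn n := by
    filter_upwards [eventually_ge_atTop (41 * (K₁ + 2) ^ 2)] with n hn
    unfold Kn
    have : K₁ + 2 ≤ Nat.sqrt (n / 41) := by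
      rw [Nat.le_sqrt]
      have : (K₁ + 2) * (K₁ + 2) ≤ n / 41 := (Nat.le_div_iff_mul_le (by norm_num)).2 (by nlinarith)
      exact this
    omega
  filter_upwards [hK₁, hKn] with n hn hKle
  have hmono : (stepFactorTrunc (Finset.univ : Finset TI) tU tV tc 16 K₁ n : ℝ) ≤ ((tailFactor n : ℕ) : ℝ) := by
    unfold tailFactor
    exact_mod_cast Nat.le_of_dvd (stepFactorTrunc_pos _ _ _ _ _ _ _) (tailFactor_mono hKle 16 n)
  refine le_trans ?_ (le_trans hn hmono)
  apply Real.exp_le_exp.2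
  have hn0 : (0 : ℝ) ≤ n := Nat.cast_nonneg n
  nlinarith [tailRate_ge]

end BrickTail

end Summit.KontsevichZagierPeriods.Zeta5Search.RecordRay
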